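import Summits.CriticalPhenomena.Ising3DConformalLimit.Theorems.FKParityRobustnessIndependentStrandsJoinShapeResidual
import Summits.CriticalPhenomena.Ising3DConformalLimit.Theorems.FKParityRobustnessIndependentStrandsJoinNonGaussianResidual
import Summits.CriticalPhenomena.Ising3DConformalLimit.Theorems.FKParityRobustnessIndependentStrandsJoinContinuumResidual
import HarnessLib

/-!
# Split check (crux-strategist s1): the proposed route-level decomposition of `IndependentStrandsJoin`
# (stmt-CriticalPhenomena-14625) into {LimitExistsISJ (= item 4738), NonGaussianLimit (= item 0636), ShapeTransferISJ}

The three children are rendered by the gate into the ROUTE FILE `Theses/FKParityRobustness.lean`, so their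
statements are written here EXACTLY as in `split/children_A1.json` (fully qualified, same `open` context as the
route file) and checked to be DEFINITIONALLY the hypotheses of the landed glue
`Summit.CriticalPhenomena.Ising3DConformalLimit.Theorems.stub_shapeResidual :
   LimitExists → NonGaussianLimit → (SME → TetraMergingEventually) → IndependentStrandsJoin`
(Theorems/FKParityRobustnessIndependentStrandsJoinShapeResidual.lean, landed 2026-08-17, lead c5-0), and of the
lead's registered stub `PinchToTetra.stub_shapeTransfer` — so the glue ITEM the split generates is closed by
`exact Theorems.stub_shapeResidual` and the child `ShapeTransferISJ` is closed by any proof of the registered stub.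
Calibration (all kernel-checked below from landed theorems): the crux implies each child that is not 4738, and
`LimitExistsISJ → (IndependentStrandsJoin ↔ NonGaussianLimit ∧ ShapeTransferISJ)`.
-/

namespace Summit.CriticalPhenomena.Ising3DConformalLimit.Theses.FKParityRobustness

open scoped BigOperators Topology Manifold Classical MeasureTheory ProbabilityTheory Matrix InnerProductSpace ComplexConjugate ContinuousMap
open Filter Set Function TopologicalSpace MeasureTheory

/-- Child 1/3 (verbatim item stmt-CriticalPhenomena-4738 `WeylWindow.LimitExists`). -/
def LimitExistsISJ : Prop :=
  ∃ (ρ : ℝ → ℝ) (S : Literature.Probability.LatticeModels.CorrFamily 3), (∀ δ ∈ Set.Ioc (0:ℝ) 1, 0 < ρ δ) ∧ Literature.Probability.LatticeModels.HasPointwiseScalingLimit (Literature.Probability.LatticeModels.criticalCorr 3) ρ S ∧ Literature.Probability.LatticeModels.IsNondegenerateTwoPoint S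

/-- Child 2/3 is the route's existing decl `NonGaussianLimit` (item 0636); restated here under a primed name only to
check that the children.json text is character-for-character its body. -/
def NonGaussianLimit' : Prop :=
  ∀ (ρ : ℝ → ℝ) (S : Literature.Probability.LatticeModels.CorrFamily 3), (∀ δ ∈ Set.Ioc (0:ℝ) 1, 0 < ρ δ) → Literature.Probability.LatticeModels.HasPointwiseScalingLimit (Literature.Probability.LatticeModels.criticalCorr 3) ρ S → Literature.Probability.LatticeModels.IsNondegenerateTwoPoint S → Literature.Probability.LatticeModels.HasNontrivialU4 S

/-- Child 3/3 (the lead's `stub_shapeTransfer`, `U4crit`/`GGcrit` unfolded, `tetra` as the crux's own `let`). -/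
def ShapeTransferISJ : Prop :=
  (∃ c : ℝ, 0 < c ∧ ∃ a : Fin 4 → Literature.Probability.LatticeModels.Site 3, Function.Injective a ∧ ∃ L₁ : ℕ, ∀ L : ℕ, L₁ ≤ L → Literature.Probability.LatticeModels.criticalCorr 3 4 (fun i => (L : ℤ) • a i) - (Literature.Probability.LatticeModels.criticalCorr 3 2 ![(L : ℤ) • a 0, (L : ℤ) • a 1] * Literature.Probability.LatticeModels.criticalCorr 3 2 ![(L : ℤ) • a 2, (L : ℤ) • a 3] + Literature.Probability.LatticeModels.criticalCorr 3 2 ![(L : ℤ) • a 0, (L : ℤ) • a 2] * Literature.Probability.LatticeModels.criticalCorr 3 2 ![(L : ℤ) • a 1, (L : ℤ) • a 3] + Literature.Probability.LatticeModels.criticalCorr 3 2 ![(L : ℤ) • a 0, (L : ℤ) • a 3] * Literature.Probability.LatticeModels.criticalCorr 3 2 ![(L : ℤ) • a 1, (L : ℤ) • a 2]) ≤ -(c * (Literature.Probability.LatticeModels.criticalCorr 3 2 ![(L : ℤ) • a 0, (L : ℤ) • a 1] * Literature.Probability.LatticeModels.criticalCorr 3 2 ![(L : ℤ) • a 2, (L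 : ℤ) • a 3]))) → (let tetra : Fin 4 → Literature.Probability.LatticeModels.Site 3 := ![![-1, -1, -1], ![1, 1, -1], ![1, -1, 1], ![-1, 1, 1]]; ∃ c : ℝ, 0 < c ∧ ∃ l₁ : ℕ, ∀ l : ℕ, l₁ ≤ l → Literature.Probability.LatticeModels.criticalCorr 3 4 (fun i => (l : ℤ) • tetra i) - (Literature.Probability.LatticeModels.criticalCorr 3 2 ![(l : ℤ) • tetra 0, (l : ℤ) • tetra 1] * Literature.Probability.LatticeModels.criticalCorr 3 2 ![(l : ℤ) • tetra 2, (l : ℤ) • tetra 3] + Literature.Probability.LatticeModels.criticalCorr 3 2 ![(l : ℤ) • tetra 0, (l : ℤ) • tetra 2] * Literature.Probability.LatticeModels.criticalCorr 3 2 ![(l : ℤ) • tetra 1, (l : ℤ) • tetra 3] + Literature.Probability.LatticeModels.criticalCorr 3 2 ![(l : ℤ) • tetra 0, (l : ℤ) • tetra 3] * Literature.Probability.LatticeModels.criticalCorr 3 2 ![(l : ℤ) • tetra 1, (l : ℤ) • tetra 2]) ≤ -(c * (Literature.Probability.LatticeModels.criticalCorr 3 2 ![(l : ℤ) • tetra 0,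 (l : ℤ) • tetra 1] * Literature.Probability.LatticeModels.criticalCorr 3 2 ![(l : ℤ) • tetra 2, (l : ℤ) • tetra 3])))

/-! ## The glue is landed: δ-unfolding only -/

example : NonGaussianLimit' ↔ NonGaussianLimit := Iff.rfl
example : LimitExistsISJ ↔ Cruxes.IndependentStrandsJoin.PinchToTetra.LimitExists := Iff.rfl

/-- The generated glue item `LimitExistsISJ → NonGaussianLimit → ShapeTransferISJ → IndependentStrandsJoin` is the landed
`Theorems.stub_shapeResidual` up to δ-unfolding. -/
theorem independentStrandsJoin_of_subs :
    LimitExistsISJ → NonGaussianLimit → ShapeTransferISJ → IndependentStrandsJoin :=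
  Summit.CriticalPhenomena.Ising3DConformalLimit.Theorems.stub_shapeResidual

/-! ## Calibration: no child overshoots; jointly exact modulo child 1 -/

/-- crux ⟹ child 2 (closed bridge `JoinForcesU4`). -/
example (h : IndependentStrandsJoin) : NonGaussianLimit :=
  Summit.CriticalPhenomena.Ising3DConformalLimit.FKParityRobustnessJoinForcesU4.joinForcesU4_proof h

/-- crux ⟹ child 3 (crux ⟹ tetrahedral merging at every scale ≥ 1). -/
example (h : IndependentStrandsJoin) : ShapeTransferISJ :=
  fun _ => Cruxes.IndependentStrandsJoin.PinchToTetra.tetraMergingEventually_of_independentStrandsJoin h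

/-- child 1 ⟹ (crux ↔ child 2 ∧ child 3). -/
example (hL : LimitExistsISJ) : IndependentStrandsJoin ↔ (NonGaussianLimit ∧ ShapeTransferISJ) :=
  Cruxes.IndependentStrandsJoin.PinchToTetra.independentStrandsJoin_iff_nonGaussian_and_shapeTransfer hL

/-- child 1 ⟹ (child 3 ↔ TNV, the continuum reading). -/
example (hL : LimitExistsISJ) : ShapeTransferISJ ↔
    ∀ (ρ : ℝ → ℝ) (S : Literature.Probability.LatticeModels.CorrFamily 3), (∀ δ ∈ Set.Ioc (0:ℝ) 1, 0 < ρ δ) →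
      Literature.Probability.LatticeModels.HasPointwiseScalingLimit (Literature.Probability.LatticeModels.criticalCorr 3) ρ S →
      Literature.Probability.LatticeModels.IsNondegenerateTwoPoint S → Literature.Probability.LatticeModels.HasNontrivialU4 S →
      Literature.Probability.LatticeModels.limitConnectedFour S Cruxes.IndependentStrandsJoin.PinchToTetra.yTetra < 0 :=
  Cruxes.IndependentStrandsJoin.PinchToTetra.shapeTransfer_iff_tnv hL

/-- The route's `closes` needs only children 2 (via the glue) — sanity: MoebiusLimit ⟹ child 1. -/
example (hM : MoebiusLimit) : LimitExistsISJ :=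
  Cruxes.IndependentStrandsJoin.PinchToTetra.limitExists_of_moebiusLimit hM

/-! ## Fallback family A3 (all-new names): {LimitExistsISJ, ShapeMergingIO, TetraNonVanishing} with landed glue
`independentStrandsJoin_of_limit_farMerging_tnv` (Theorems/…ContinuumResidual.lean). -/

/-- Far merging INFINITELY OFTEN along the dilations of SOME injective lattice shape (antecedent of the closed glue
`FarMergingGivesU4`, item 4471; ⟹ NonGaussianLimit outright, ⟸ under LimitExistsISJ). -/
def ShapeMergingIO : Prop :=
  ∃ c : ℝ, 0 < c ∧ ∃ x : Fin 4 → Literature.Probability.LatticeModels.Site 3, Function.Injective x ∧ ∀ L₀ : ℕ, ∃ L : ℕ, L₀ ≤ L ∧ Literature.Probability.LatticeModels.criticalCorr 3 4 (fun i => (L : ℤ) • x i) - (Literature.Probability.LatticeModels.criticalCorr 3 2 ![(L : ℤ) • x 0, (L : ℤ) • x 1] * Literature.Probability.LatticeModels.criticalCorr 3 2 ![(L : ℤ) • x 2, (L : ℤ) • x 3] + Literature.Probability.LatticeModels.criticalCorr 3 2 ![(L : ℤ) • x 0, (L : ℤ) • x 2] * Literature.Probability.LatticeModels.criticalCorr 3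 2 ![(L : ℤ) • x 1, (L : ℤ) • x 3] + Literature.Probability.LatticeModels.criticalCorr 3 2 ![(L : ℤ) • x 0, (L : ℤ) • x 3] * Literature.Probability.LatticeModels.criticalCorr 3 2 ![(L : ℤ) • x 1, (L : ℤ) • x 2]) ≤ -(c * (Literature.Probability.LatticeModels.criticalCorr 3 2 ![(L : ℤ) • x 0, (L : ℤ) • x 1] * Literature.Probability.LatticeModels.criticalCorr 3 2 ![(L : ℤ) • x 2, (L : ℤ) • x 3]))

/-- TNV: every non-degenerate pointwise limit with `U₄ ≢ 0` has `U₄(S)(y_tetra) < 0` (continuum form of child 3). -/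
def TetraNonVanishing : Prop :=
  ∀ (ρ : ℝ → ℝ) (S : Literature.Probability.LatticeModels.CorrFamily 3), (∀ δ ∈ Set.Ioc (0:ℝ) 1, 0 < ρ δ) →
    Literature.Probability.LatticeModels.HasPointwiseScalingLimit (Literature.Probability.LatticeModels.criticalCorr 3) ρ S →
    Literature.Probability.LatticeModels.IsNondegenerateTwoPoint S → Literature.Probability.LatticeModels.HasNontrivialU4 S →
    Literature.Probability.LatticeModels.limitConnectedFour S (fun i => WithLp.toLp 2 fun k => (((![![-1, -1, -1], ![1, 1, -1], ![1, -1, 1], ![-1, 1, 1]] : Fin 4 → Literature.Probability.LatticeModels.Site 3) i k : ℤ) : ℝ)) < 0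

theorem independentStrandsJoin_of_subs_A3 :
    LimitExistsISJ → ShapeMergingIO → TetraNonVanishing → IndependentStrandsJoin :=
  fun hL hfm htnv => Cruxes.IndependentStrandsJoin.PinchToTetra.independentStrandsJoin_of_limit_farMerging_tnv hL hfm htnv

example (h : ShapeMergingIO) : NonGaussianLimit :=
  Summit.CriticalPhenomena.Ising3DConformalLimit.FKParityRobustnessFarMergingGivesU4.farMergingGivesU4_proof h

end Summit.CriticalPhenomena.Ising3DConformalLimit.Theses.FKParityRobustness
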